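import Summits.BirchSwinnertonDyer.BirchSwinnertonDyer.Theorems.GenusKolyvaginAtTwoPowDvdShaCardAtTwoRTDropChebotarevPair
import HarnessLib

/-!
# Route `GenusKolyvaginAtTwo`, LINE 18 (L_T `PowDvdShaCardAtTwoRT`, stmt-BirchSwinnertonDyer-23659), road (E4), P-reduction —
# THE TWO ČEBOTAREV CHOICES OF KOLYVAGIN'S RANK DESCENT AT `2`, for a SELMER eigenclass against a Kolyvagin class / a carrier class

Seat `bsd-line-gk2-p4` g21 (WIDTH-5 attach, cell `bsd-f1-sign2`), `--supports stmt-BirchSwinnertonDyer-23659` (helper; closes nothing).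
THEOREMS ONLY (no definition, no named fact, no `sorry`).  BSD is NOT proved by any of this; neither is the crux.

WHY.  The K-side capstone of road (E4) uses the print bundle `PubInputsAtTwo` only as «rank E(K) ≤ 1» (`…RTOrthogonalCapstoneRankLeOne`).
Kolyvagin's rank descent (Gross 1991 §10, Claims 10.1/10.3) at `p = 2` on L_T's habitat needs two Čebotarev choices for an ARBITRARY Selmer
eigenclass `s ∈ Sel_{2^L}(E/K)` (not a Kolyvagin class): (1) a Kolyvagin prime at which `s` AND a Kolyvagin class `c_L(n)` both have FULL
local order (gk2-p2's signed full-order pair Čebotarev `PlusDescent.infinite_kolyvaginPrime_localization_fullOrder_pair`, socles handled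
there); (2) a Kolyvagin prime at which a second Selmer eigenclass `q` (the carrier of `δ y_K`) has a PRESCRIBED local order while `s`
VANISHES locally — McCallum's Cor. 3.2 at `2` for the independent pair `{q, s}` (Q5R `GenusExact.equivariantChebotarevAtTwo_eigen_of_not_isSquare`,
independence from `⟨s⟩ ∩ ⟨q⟩ = 0`).  In both, Q5R's separation hypothesis is (NPh_L) (`RelaxedCount.eq_zero_of_phantom_of_selmer_outside_pow`),
Selmer classes being Selmer everywhere and `c_L(n)` off `n` (Gross 6.2(1) at `2`, odd Tamagawa).  Adapted from the sibling file
`…RTDropChebotarevPair` (gk2-p4 g19).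
* `exists_kolyvaginPrime_fullOrder_selmer_kolyvagin` — choice (1);  * `exists_kolyvaginPrime_prescribed_selmer_pair` — choice (2).

References: [McCallumLMS1991] §3 Cor. 3.2; [GrossLMS1991] §10 (Claims 10.1, 10.3), Prop. 5.4, Prop. 6.2 (1); [Kolyvagin1991MathAnn] §1.
-/

set_option autoImplicit false
-- the Theorems namespace of this sub repeats the summit name by design (D-0017 nested layout)
set_option linter.dupNamespace false

noncomputable section

open scoped Classical

open Field NumberField IsDedekindDomain Function WeierstrassCurve Rat.HeightOneSpectrum
open Literature.NumberTheory.EllipticCurves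
open Literature.NumberTheory.GaloisRepresentations
open Summit.BirchSwinnertonDyer.BirchSwinnertonDyer.Theorems.GenusExact.VisiblePairAtTwo
  (natCast_mem_primesEquiv_symm natCast_prime_mem_iff_eq natCast_mem_of_liesOver)
open Summit.BirchSwinnertonDyer.BirchSwinnertonDyer.Theorems.GenusExact.RelaxedCount
  (exists_primeFactor_natCast_mem_of_natCast_mem eq_zero_of_phantom_of_selmer_outside_pow)

namespace Summit.BirchSwinnertonDyer.BirchSwinnertonDyer.Theorems.GenusExact.PlusDescent

section Cheb

variable (W : WeierstrassCurve ℚ) [W.IsElliptic] [W.IsGloballyMinimal]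

/-- **Čebotarev choice (1): a Selmer eigenclass and a Kolyvagin class both of FULL local order at one new Kolyvagin prime.**  Frame as in
`RelaxedCount.exists_deep_kolyvaginPrime_fullOrder_pair_of_data` (non-CM, `Δ < 0`, odd Tamagawa, `ρ_{E,2^∞}` onto; `K` imaginary quadratic,
`d_K` odd `≠ −3`, Heegner, `d_K·(−|Δ|)` non-square; `σ ≠ 1`; level `L ≥ 1` with (NPh_L)).  Data: a Selmer class `s ∈ Sel_{2^L}(E/K)` with
`σ_* s = ±s` of order `2^a` (`a ≥ 1`); a square-free product `n₂` of Zhang–Kolyvagin primes of index `≥ L` with a datum `d₂` whose class has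
order `2^b` (`b ≥ 1`); a finite exceptional set `S₀`.  CONCLUSION: a Zhang–Kolyvagin prime `ℓ ∉ S₀`, `ℓ ∤ n₂`, of index `≥ L` with
`Frob_ℓ = Frob_∞` on `K(E[2^L])`, at whose place `s` has local order exactly `2^a` and `c_L(d₂)` exactly `2^b`.
[cite: McCallumLMS1991, §3 Cor. 3.2] [cite: GrossLMS1991, §10 Claim 10.1, Prop. 5.4, Prop. 6.2 (1)] -/
theorem exists_kolyvaginPrime_fullOrder_selmer_kolyvagin [NeZero (W.conductorNorm ℤ)] (hcm : ¬ W.HasCM) (hΔ : W.Δ < 0)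
    (hT : Odd W.tamagawaProduct) (hρ : ∀ n : ℕ, W.HasSurjectiveModNGaloisRep (2 ^ n : ℕ))
    {K : Type} [Field K] [NumberField K] (hK : IsImaginaryQuadratic K) (hodd : Odd (NumberField.discr K))
    (h3 : NumberField.discr K ≠ -3) (hH : SatisfiesHeegnerHypothesis (W.conductorNorm ℤ) K)
    (hns : ¬ IsSquare ((NumberField.discr K : ℚ) * -|W.Δ|)) (σ : K ≃ₐ[ℚ] K) (hσ : σ ≠ 1)
    {Dt : ModularForms.ModularParametrizationData W (W.conductorNorm ℤ)} {β : ℤ} {ι : K →+* ℂ} {L : ℕ} (hL : 1 ≤ L)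
    (hNPh : ∀ z : galH1Torsion (W.baseChange K) ((2 ^ L : ℕ) : ℤ),
      (∀ ρ ∈ torsionFixing (W.baseChange K) ((2 ^ L : ℕ) : ℤ), h1Eval (W.baseChange K) ((2 ^ L : ℕ) : ℤ) z ρ = 0) →
      (∀ w : HeightOneSpectrum (𝓞 K), z ∈ selmerLocalKer (W.baseChange K) (w.adicCompletion K) ((2 ^ L : ℕ) : ℤ)) → z = 0)
    (s : galH1Torsion (W.baseChange K) ((2 ^ L : ℕ) : ℤ)) (hsSel : s ∈ selmerGroup (W.baseChange K) ((2 ^ L : ℕ) : ℤ))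
    {εs : ℤ} (hεs : εs = 1 ∨ εs = -1) (hτs : conjAct W σ ((2 ^ L : ℕ) : ℤ) s = εs • s)
    {a : ℕ} (ha : 1 ≤ a) (hords : addOrderOf s = 2 ^ a)
    {n₂ : ℕ} (hn₂ : Squarefree n₂)
    (hK₂ : ∀ q ∈ n₂.primeFactors, Zhang2014.IsKolyvaginPrime (W.conductorNorm ℤ) W K 2 q ∧ L ≤ Zhang2014.kolyvaginIndex W 2 q)
    (d₂ : KolyvaginHeegnerData Dt β ι n₂) {b : ℕ} (hb : 1 ≤ b)
    (hord₂ : addOrderOf (d₂.kolyvaginClass Nat.prime_two L) = 2 ^ b) (S₀ : Finset ℕ) :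
    ∃ ℓ : ℕ, ℓ ∉ S₀ ∧ ℓ ∉ n₂.primeFactors ∧
      Zhang2014.IsKolyvaginPrime (W.conductorNorm ℤ) W K 2 ℓ ∧ L ≤ Zhang2014.kolyvaginIndex W 2 ℓ ∧ FrobEqFrobInfty W K (2 ^ L) ℓ ∧
      ∀ v : HeightOneSpectrum (𝓞 K), (ℓ : 𝓞 K) ∈ v.asIdeal →
        (∀ j : ℕ, ((2 ^ j : ℕ) : ℤ) • s ∈
            (W.baseChange K).torsionLocalKer (v.adicCompletion K) ((2 ^ L : ℕ) : ℤ) ↔ a ≤ j) ∧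
        ∀ j : ℕ, ((2 ^ j : ℕ) : ℤ) • d₂.kolyvaginClass Nat.prime_two L ∈
            (W.baseChange K).torsionLocalKer (v.adicCompletion K) ((2 ^ L : ℕ) : ℤ) ↔ b ≤ j := by
  haveI : Fact (Nat.Prime 2) := ⟨Nat.prime_two⟩
  have h4 : NumberField.discr K ≠ -4 := by
    intro h
    have hD : NumberField.discr K < -4 := by
      have hgt : 2 < |NumberField.discr K| := NumberField.abs_discr_gt_two (by rw [hK.1]; exact one_lt_two)
      rw [abs_of_neg hK.discr_neg] at hgt
      obtain ⟨r, hr⟩ := hodd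
      omega
    omega
  have hsurj1 : W.HasSurjectiveModNGaloisRep ((2 : ℤ) ^ 1) := by simpa using hρ 1
  have hsurjk : ∀ j : ℕ, W.HasSurjectiveModNGaloisRep ((2 ^ j : ℕ) : ℤ) := fun j ↦ by exact_mod_cast hρ j
  set y := d₂.kolyvaginClass Nat.prime_two L with hy_def
  -- ### sign of the Kolyvagin class (Gross 5.4 at `2`)
  obtain ⟨hs₂, hτ₂⟩ := KolyvaginClassSign.sign_conjAct_kolyvaginClass_two hK h3 h4 hodd hH hsurj1 σ hσ Dt β ι hn₂ hL hK₂ d₂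
  -- ### the places of the primes of `n₂`
  set T : Finset (Place ℚ) := ((n₂.primeFactors).subtype Nat.Prime).image
    (fun p ↦ (Sum.inr ((primesEquiv (R := 𝓞 ℚ)).symm p) : Place ℚ)) with hT_def
  have hTmem : ∀ {v : HeightOneSpectrum (𝓞 ℚ)} {q : ℕ}, q ∈ n₂.primeFactors → (q : 𝓞 ℚ) ∈ v.asIdeal →
      (Sum.inr v : Place ℚ) ∈ T := by
    intro v q hq hqv
    have hqp : q.Prime := Nat.prime_of_mem_primeFactors hq
    rw [hT_def, Finset.mem_image]
    refine ⟨⟨q, hqp⟩, Finset.mem_subtype.mpr hq, ?_⟩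
    rw [(natCast_prime_mem_iff_eq hqp v).mp hqv]
  have hTdesc : ∀ u ∈ T, ∃ (v : HeightOneSpectrum (𝓞 ℚ)) (ℓ : ℕ), u = Sum.inr v ∧ ℓ.Prime ∧ (ℓ : 𝓞 ℚ) ∈ v.asIdeal ∧
      Zhang2014.IsKolyvaginPrime (W.conductorNorm ℤ) W K 2 ℓ ∧ L ≤ Zhang2014.kolyvaginIndex W 2 ℓ := by
    intro u hu
    rw [hT_def, Finset.mem_image] at hu
    obtain ⟨p, hp, rfl⟩ := hu
    have hpS := Finset.mem_subtype.mp hp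
    exact ⟨_, p.1, rfl, p.2, natCast_mem_primesEquiv_symm p.2, hK₂ _ hpS⟩
  -- ### the Kolyvagin class is Selmer off `T` (Gross 6.2(1) at `2`); the Selmer class everywhere
  have hsel₂ : ∀ w : HeightOneSpectrum (𝓞 K), (Sum.inr (w.under (𝓞 ℚ)) : Place ℚ) ∉ T →
      y ∈ selmerLocalKer (W.baseChange K) (w.adicCompletion K) ((2 ^ L : ℕ) : ℤ) := by
    intro w hw
    refine RankOneAtTwoOneDoor.kolyvaginClass_two_mem_selmerLocalKer_of_odd_tamagawaProduct W hsurjk hT K hK h3 h4 hH Dt β ι L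
      hn₂ hK₂ d₂ w fun hnw ↦ ?_
    haveI : w.asIdeal.LiesOver (w.under (𝓞 ℚ)).asIdeal := ⟨rfl⟩
    obtain ⟨q, hq, hqv⟩ := exists_primeFactor_natCast_mem_of_natCast_mem hn₂.ne_zero (w.under (𝓞 ℚ)) w hnw
    exact hw (hTmem hq hqv)
  have hsels : ∀ w : HeightOneSpectrum (𝓞 K), s ∈ selmerLocalKer (W.baseChange K) (w.adicCompletion K) ((2 ^ L : ℕ) : ℤ) :=
    fun w ↦ (((W.baseChange K).mem_selmerGroup_iff _ s).mp hsSel).1 w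
  -- ### Q5R's separation hypothesis for `⟨s, y⟩` from (NPh_L)
  have hres : ∀ a' b' : ℤ, (∀ ρ ∈ torsionFixing (W.baseChange K) ((2 ^ L : ℕ) : ℤ),
      h1Eval (W.baseChange K) ((2 ^ L : ℕ) : ℤ) (a' • s + b' • y) ρ = 0) → a' • s + b' • y = 0 := by
    intro a' b' hab
    refine eq_zero_of_phantom_of_selmer_outside_pow W hK T hTdesc hNPh hab fun w hw ↦ ?_
    exact add_mem (AddSubgroup.zsmul_mem _ (hsels w) a') (AddSubgroup.zsmul_mem _ (hsel₂ w hw) b')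
  -- ### the pair Čebotarev, avoiding `S₀` and the primes of `n₂`
  have hinf := PlusDescent.infinite_kolyvaginPrime_localization_fullOrder_pair (W.conductorNorm ℤ) W hcm hΔ K hK hns hρ σ hσ L hL
    s y ha hb hords hord₂ hεs hs₂ hτs hτ₂ hres
  obtain ⟨ℓ, hℓmem, hℓE⟩ := hinf.exists_notMem_finset (S₀ ∪ n₂.primeFactors)
  obtain ⟨hFrob, hKol, hidx, hloc⟩ := hℓmem
  simp only [Finset.mem_union, not_or] at hℓE
  obtain ⟨hℓS₀, hℓn₂⟩ := hℓE
  exact ⟨ℓ, hℓS₀, hℓn₂, hKol, hidx, hFrob, fun v hv ↦ hloc v hv⟩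

/-- **Čebotarev choice (2): two INDEPENDENT Selmer eigenclasses with PRESCRIBED local orders at one new Kolyvagin prime** (McCallum's
Cor. 3.2 at `2`, Q5R BY NAME).  Same frame; `q, s ∈ Sel_{2^L}(E/K)` eigenclasses of `σ_*` (any signs) of orders `2^{Mq}`, `2^{Ms}`
(`Mq, Ms ≥ 1`) with `⟨s⟩ ∩ ⟨q⟩ = 0`, prescriptions `Nq ≤ Mq`, `Ns ≤ Ms`.  CONCLUSION: a Zhang–Kolyvagin prime `ℓ ∉ S₀` of index `≥ L` with
`Frob_ℓ = Frob_∞` on `K(E[2^L])` at whose place `q` has local order exactly `2^{Nq}` and `s` exactly `2^{Ns}` (e.g. `Ns = 0`: `s` vanishes there).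
[cite: McCallumLMS1991, §3 Cor. 3.2] [cite: GrossLMS1991, §10 Claim 10.3 (Step B)] -/
theorem exists_kolyvaginPrime_prescribed_selmer_pair [NeZero (W.conductorNorm ℤ)] (hcm : ¬ W.HasCM) (hΔ : W.Δ < 0)
    (hρ : ∀ n : ℕ, W.HasSurjectiveModNGaloisRep (2 ^ n : ℕ))
    {K : Type} [Field K] [NumberField K] (hK : IsImaginaryQuadratic K)
    (hns : ¬ IsSquare ((NumberField.discr K : ℚ) * -|W.Δ|)) (σ : K ≃ₐ[ℚ] K) (hσ : σ ≠ 1)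
    {L : ℕ} (hL : 1 ≤ L)
    (hNPh : ∀ z : galH1Torsion (W.baseChange K) ((2 ^ L : ℕ) : ℤ),
      (∀ ρ ∈ torsionFixing (W.baseChange K) ((2 ^ L : ℕ) : ℤ), h1Eval (W.baseChange K) ((2 ^ L : ℕ) : ℤ) z ρ = 0) →
      (∀ w : HeightOneSpectrum (𝓞 K), z ∈ selmerLocalKer (W.baseChange K) (w.adicCompletion K) ((2 ^ L : ℕ) : ℤ)) → z = 0)
    (q s : galH1Torsion (W.baseChange K) ((2 ^ L : ℕ) : ℤ))
    (hqSel : q ∈ selmerGroup (W.baseChange K) ((2 ^ L : ℕ) : ℤ)) (hsSel : s ∈ selmerGroup (W.baseChange K) ((2 ^ L : ℕ) : ℤ))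
    {εq εs : ℤ} (hεq : εq = 1 ∨ εq = -1) (hεs : εs = 1 ∨ εs = -1)
    (hτq : conjAct W σ ((2 ^ L : ℕ) : ℤ) q = εq • q) (hτs : conjAct W σ ((2 ^ L : ℕ) : ℤ) s = εs • s)
    {Mq Ms : ℕ} (hMq : 1 ≤ Mq) (hMs : 1 ≤ Ms) (hordq : addOrderOf q = 2 ^ Mq) (hords : addOrderOf s = 2 ^ Ms)
    (hdisj : Disjoint (AddSubgroup.zmultiples s) (AddSubgroup.zmultiples q))
    {Nq Ns : ℕ} (hNq : Nq ≤ Mq) (hNs : Ns ≤ Ms) (S₀ : Finset ℕ) :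
    ∃ ℓ : ℕ, ℓ ∉ S₀ ∧
      Zhang2014.IsKolyvaginPrime (W.conductorNorm ℤ) W K 2 ℓ ∧ L ≤ Zhang2014.kolyvaginIndex W 2 ℓ ∧ FrobEqFrobInfty W K (2 ^ L) ℓ ∧
      ∀ v : HeightOneSpectrum (𝓞 K), (ℓ : 𝓞 K) ∈ v.asIdeal →
        (∀ j : ℕ, ((2 ^ j : ℕ) : ℤ) • q ∈
            (W.baseChange K).torsionLocalKer (v.adicCompletion K) ((2 ^ L : ℕ) : ℤ) ↔ Nq ≤ j) ∧
        ∀ j : ℕ, ((2 ^ j : ℕ) : ℤ) • s ∈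
            (W.baseChange K).torsionLocalKer (v.adicCompletion K) ((2 ^ L : ℕ) : ℤ) ↔ Ns ≤ j := by
  haveI : Fact (Nat.Prime 2) := ⟨Nat.prime_two⟩
  have hq0 : q ≠ 0 := ne_zero_of_addOrderOf_eq_two_pow hMq hordq
  have hs0 : s ≠ 0 := ne_zero_of_addOrderOf_eq_two_pow hMs hords
  have hsels : ∀ w : HeightOneSpectrum (𝓞 K), s ∈ selmerLocalKer (W.baseChange K) (w.adicCompletion K) ((2 ^ L : ℕ) : ℤ) :=
    fun w ↦ (((W.baseChange K).mem_selmerGroup_iff _ s).mp hsSel).1 w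
  have hselq : ∀ w : HeightOneSpectrum (𝓞 K), q ∈ selmerLocalKer (W.baseChange K) (w.adicCompletion K) ((2 ^ L : ℕ) : ℤ) :=
    fun w ↦ (((W.baseChange K).mem_selmerGroup_iff _ q).mp hqSel).1 w
  -- ### independence of `{q, s}` from disjointness
  have hind : ∀ c : Fin 2 → ℤ, ∑ i, c i • (![q, s] i) = 0 → ∀ i, (addOrderOf (![q, s] i) : ℤ) ∣ c i := by
    intro c hc
    simp only [Fin.sum_univ_two, Fin.isValue, Matrix.cons_val_zero, Matrix.cons_val_one] at hc
    -- `c₀ q = -(c₁ s) ∈ ⟨q⟩ ∩ ⟨s⟩ = 0`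
    have hmem : c 1 • s ∈ AddSubgroup.zmultiples s ⊓ AddSubgroup.zmultiples q := by
      refine ⟨AddSubgroup.zsmul_mem _ (AddSubgroup.mem_zmultiples s) _, ?_⟩
      have : c 1 • s = -(c 0 • q) := eq_neg_of_add_eq_zero_right hc
      rw [this]
      exact AddSubgroup.neg_mem _ (AddSubgroup.zsmul_mem _ (AddSubgroup.mem_zmultiples q) _)
    rw [hdisj.eq_bot, AddSubgroup.mem_bot] at hmem
    rw [hmem, add_zero] at hc
    intro i
    fin_cases i
    · show ((addOrderOf q : ℕ) : ℤ) ∣ c 0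
      rw [addOrderOf_dvd_iff_zsmul_eq_zero]
      exact hc
    · show ((addOrderOf s : ℕ) : ℤ) ∣ c 1
      rw [addOrderOf_dvd_iff_zsmul_eq_zero]
      exact hmem
  -- ### Q5R's separation hypothesis for `⟨q, s⟩` from (NPh_L) (both Selmer everywhere: `T = ∅`)
  have hres : ∀ c : Fin 2 → ℤ, (∀ ρ ∈ torsionFixing (W.baseChange K) ((2 ^ L : ℕ) : ℤ),
      h1Eval (W.baseChange K) ((2 ^ L : ℕ) : ℤ) (∑ i, c i • (![q, s] i)) ρ = 0) → ∑ i, c i • (![q, s] i) = 0 := by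
    intro c hc
    refine eq_zero_of_phantom_of_selmer_outside_pow W hK (∅ : Finset (Place ℚ)) (by simp) hNPh hc fun w _ ↦ ?_
    simp only [Fin.sum_univ_two, Fin.isValue, Matrix.cons_val_zero, Matrix.cons_val_one]
    exact add_mem (AddSubgroup.zsmul_mem _ (hselq w) _) (AddSubgroup.zsmul_mem _ (hsels w) _)
  have hQ := equivariantChebotarevAtTwo_eigen_of_not_isSquare (W.conductorNorm ℤ) W hcm hΔ K hK hns hρ σ hσ L hL 2 ![q, s]
    ![εq, εs] (fun i ↦ by fin_cases i <;> assumption) (fun i ↦ by fin_cases i <;> assumption)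
    (fun i ↦ by fin_cases i <;> assumption) hind hres ![Mq, Ms] (fun i ↦ by fin_cases i <;> assumption) ![Nq, Ns]
    (fun i ↦ by fin_cases i <;> assumption)
  obtain ⟨ℓ, hℓmem, hℓS₀⟩ := hQ.exists_notMem_finset S₀
  obtain ⟨hFrob, hKol, hidx, hloc⟩ := hℓmem
  refine ⟨ℓ, hℓS₀, hKol, hidx, hFrob, fun v hv ↦ ⟨fun j ↦ ?_, fun j ↦ ?_⟩⟩
  · simpa using hloc 0 v hv j
  · simpa using hloc 1 v hv j

end Cheb

end Summit.BirchSwinnertonDyer.BirchSwinnertonDyer.Theorems.GenusExact.PlusDescent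

end
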